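import Summits.QuantumFields.YangMills.Theorems.BalabanUVNodesN15KingModelProperTimeRepresentation
import Summits.QuantumFields.YangMills.Theorems.BalabanUVNodesN15KingModelSchwingerFunctionsThermodynamicLimit

/-!
# BalabanUVNodes ∕ N15 — THE KING-MODEL RUNG (PART Ϻ-e): STRICT POSITIVITY OF ALL EVEN SCHWINGER FUNCTIONS OF KING's CONTINUUM BLOCK FIELD IN THE THERMODYNAMIC LIMIT
# (Griffiths' first inequality for the free block field: `Haf((S₂^{ℝ}(z_v − z_u))_{u,v∈S}) > 0` for `|S|` even, `= 0` for `|S|` odd)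
# (Track A, DAG node N15 = NE2; FAN-OUT v1.1 §N15 s3 «KING-MODEL RUNG»; uses parts Ϻ-b (`kingS2Inf_pos`), Ϸ-d (the hafnian limit); count-neutral)

HONEST FRAMING.  Count-neutral (cell `pub-ymgap`, seat `pub-ymgap-dag-n15-e` g35; `--supports stmt-QuantumFields-27366 --as helper` = K3⁸).  King's `A = 0`, `g = 0` model
([King1986] C. King, Commun. Math. Phys. **102** (1986) 649–677).  Part Ϸ-d identified the thermodynamic limit of every `n`-point Schwinger function of the `K = ∞` block
field (Theorem 2.1's continuum limit) as the hafnian `Haf((S₂^{ℝ}(z_v − z_u))_{u,v∈S})` of the infinite-volume two-point function; part Ϻ-b proved `S₂^{ℝ}(z) > 0` for EVERY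
`z`.  Since the hafnian is a sum over perfect matchings of products of entries, and perfect matchings exist exactly when `|S|` is even ((2k−1)!! of them, the tree's
`card_perfectMatchings_of_even`), EVERY EVEN `n`-point function of King's continuum block field is STRICTLY POSITIVE in the thermodynamic limit (and every odd one vanishes):
the free-field instance of Griffiths' first inequality, and, by part Ϸ-d's convergence, the finite-volume `n`-point functions on all sufficiently large tori are positive too.
NOT Bałaban's objects; NOT a node discharge; nothing continuum-Yang–Mills ∕ `ℝ⁴` ∕ OS ∕ Clay.  0 `sorry`, 0 def; standard axioms.

WHAT THIS FILE PROVES (kernel).  §1 (generic, real matrices) `hafnian_nonneg_of_nonneg`, `perfectMatchings_nonempty_of_even`, ★ `hafnian_pos_of_pos`.  §2 KING: ★ `hafnian_kingS2Inf_nonneg`,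
★★★ **`hafnian_kingS2Inf_pos`** (`|S|` even), ★★ `hafnian_kingS2Inf_pos_iff_even`, ★★ **`eventually_nPoint_fineBlockLawLim_pos`** (finite volume, all large tori).

HONEST SCOPE.  King's free model, `m² > 0`; thermodynamic limit of the `K = ∞` block field (part Ϸ-d's order of limits).  N15 untouched; counts unmoved.  Locators (use): [King1986]
Thm 2.1 (2.22)–(2.23) p.654, (4.5) p.670.
-/

noncomputable section

open scoped BigOperators Topology
open Filter MeasureTheory

namespace Summit.QuantumFields.YangMills.BalabanUVNodes.N15KingModelRung.ProperTime

open Literature.MathematicalPhysics.QuantumFieldTheory.Balaban1983to89.B5Prop11Plancherel (Tor)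
open Literature.Combinatorics.Enumerative (hafnian perfectMatchings mem_perfectMatchings card_perfectMatchings_of_even)
open Literature.Combinatorics.Enumerative.HafnianGeneratingFunction (subMat)
open FreeField

variable {d : ℕ}

/-! ## §1 Hafnians of entrywise nonnegative ∕ positive real matrices -/

section Generic

variable {V : Type*} [Fintype V] [DecidableEq V] [LinearOrder V]

/-- The hafnian of an entrywise nonnegative real matrix is nonnegative. [folklore] -/
theorem hafnian_nonneg_of_nonneg {A : Matrix V V ℝ} (hA : ∀ u v, 0 ≤ A u v) : 0 ≤ hafnian A :=
  Finset.sum_nonneg fun _ _ => Finset.prod_nonneg fun _ _ => hA _ _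

omit [LinearOrder V] in
/-- Perfect matchings exist on a set of even size (there are `(|V|−1)!!` of them). [folklore] -/
theorem perfectMatchings_nonempty_of_even (h : Even (Fintype.card V)) : (perfectMatchings V).Nonempty := by
  rw [← Finset.card_pos, card_perfectMatchings_of_even h]
  exact Nat.doubleFactorial_pos _

/-- ★ The hafnian of an entrywise POSITIVE real matrix of even size is positive. [folklore] -/
theorem hafnian_pos_of_pos {A : Matrix V V ℝ} (hA : ∀ u v, 0 < A u v) (h : Even (Fintype.card V)) : 0 < hafnian A :=
  Finset.sum_pos (fun _ _ => Finset.prod_pos fun _ _ => hA _ _) (perfectMatchings_nonempty_of_even h)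

end Generic

/-! ## §2 King's continuum block field: all even Schwinger functions are strictly positive -/

section King

variable {W : Type*} [DecidableEq W] [LinearOrder W]

/-- ★ Every thermodynamic-limit `n`-point function of King's continuum block field is `≥ 0`. [cite: King1986, Thm 2.1 (2.22) p.654] -/
theorem hafnian_kingS2Inf_nonneg {m2 : ℝ} (hm : 0 < m2) (z : W → Fin (d + 1) → ℤ) (S : Finset W) :
    0 ≤ hafnian (subMat (Matrix.of fun u v : W => kingS2Inf m2 (z v - z u)) S) :=
  hafnian_nonneg_of_nonneg fun _ _ => (kingS2Inf_pos hm _).le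

/-- ★★★ **GRIFFITHS' FIRST INEQUALITY, FREE BLOCK FIELD**: for `|S|` EVEN, the thermodynamic-limit `|S|`-point Schwinger function `Haf((S₂^{ℝ}(z_v − z_u))_{u,v∈S})` is STRICTLY
POSITIVE (every `d`, `m² > 0`, every configuration `z`, coincident points allowed). [cite: King1986, Thm 2.1 (2.22) p.654; folklore (Griffiths)] -/
theorem hafnian_kingS2Inf_pos {m2 : ℝ} (hm : 0 < m2) (z : W → Fin (d + 1) → ℤ) {S : Finset W} (hS : Even S.card) :
    0 < hafnian (subMat (Matrix.of fun u v : W => kingS2Inf m2 (z v - z u)) S) :=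
  hafnian_pos_of_pos (fun _ _ => kingS2Inf_pos hm _) (by rwa [Fintype.card_coe])

/-- ★★ **The parity dichotomy**: the thermodynamic-limit `|S|`-point function is `> 0` iff `|S|` is even (and `= 0` iff `|S|` is odd, part Ϸ-d). [cite: King1986, Thm 2.1 (2.22) p.654] -/
theorem hafnian_kingS2Inf_pos_iff_even {m2 : ℝ} (hm : 0 < m2) (z : W → Fin (d + 1) → ℤ) (S : Finset W) :
    0 < hafnian (subMat (Matrix.of fun u v : W => kingS2Inf m2 (z v - z u)) S) ↔ Even S.card := by
  refine ⟨fun h => ?_, hafnian_kingS2Inf_pos hm z⟩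
  by_contra hodd
  rw [Nat.not_even_iff_odd] at hodd
  rw [hafnian_kingS2Inf_eq_zero_of_odd m2 z hodd] at h
  exact lt_irrefl _ h

/-- ★★ **Finite volume, all large tori**: for `|S|` even and ANY sequence of unit tori with all periods `→ ∞`, the `|S|`-point function of the `K = ∞` block field
`∫∏_{i∈S}φ(z_i mod Ω_k)ρ_{P_∞,Ω_k}(φ)dφ` is STRICTLY POSITIVE for all sufficiently large `k`. [cite: King1986, Thm 2.1 (2.22)–(2.23) p.654] -/
theorem eventually_nPoint_fineBlockLawLim_pos {m2 : ℝ} (hm : 0 < m2) (Mseq : ℕ → Fin (d + 1) → ℕ) (hpos : ∀ k ν, 0 < Mseq k ν)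
    (hlim : ∀ ν, Tendsto (fun k => (Mseq k ν : ℝ)) atTop atTop) (z : W → Fin (d + 1) → ℤ) {S : Finset W} (hS : Even S.card) :
    ∀ᶠ k in atTop, haveI : ∀ ν, NeZero (Mseq k ν) := fun ν => ⟨(hpos k ν).ne'⟩
      0 < ∫ φ : Tor (Mseq k) → ℝ, (∏ i ∈ S, φ (fun ν => ((z i ν : ℤ) : ZMod (Mseq k ν)))) * gaussDensity (fineBlockPrecLim (Mseq k) m2) φ :=
  (tendsto_integral_prod_eval_fineBlockLawLim_volume hm Mseq hpos hlim z S).eventually (lt_mem_nhds (hafnian_kingS2Inf_pos hm z hS))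

end King

end Summit.QuantumFields.YangMills.BalabanUVNodes.N15KingModelRung.ProperTime
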